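import Literature.Geometry.ComplexAnalytic.PhamBrieskornCyclicNodeSphereTransversal
import HarnessLib

/-!
# The fibres of the suspended `A_{p−1}` point `z₀² + ⋯ + zₘ² + z_{m+1}^p` are transverse to the small spheres
# (any number of quadratic coordinates): tangency only at `|c| = r²`, `|c|² = r^{2p}` or `|z_{m+1}|^{p−2} = 2/p`

Layer `Literature/Geometry/ComplexAnalytic`; theorems only (no definition, no named fact). Written by the prover seat
`hodge-nonav-prover-Bx` (g16, cell `hodge-nonav`) as brick B4b of the programme «A₃-TRACE» (binder hN `stub_a3NonComm` of crux
K1-B `VeryGeneralSignCommutatorsInHg`, `Summits/HodgeConjecture/HodgeConjecture/Theses/SignSymmetricPowers.lean`,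
stmt-HodgeConjecture-19716; memo `HOME/memos/PROGRAMME-A3-TRACE-Bx-g16.md` §3): the model of the pencil coordinate at a
symmetric `A₃` point is `u⁴ + Σ vⱼ²` — exponents `(2, …, 2, 4)` — and the geometric monodromy is built from vector fields
tangent to the Milnor spheres in a shell, which needs the fibres `{P = c}` to cross the spheres transversally there.

This is prover-Ax's `PhamBrieskornCyclicNodeSphereTransversal` (exponents `(2, 2, p)`, three variables) in ANY number `m + 2`
of variables, for exponent vectors `a : Fin (m + 2) → ℕ` with `a i = 2` for `i ≠ last` and `a last = p` (no definition is
introduced; the hypotheses `h2`, `hp` carry the shape):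

* `suspendedNode_tangency_trichotomy` — if `conj zᵢ = κ · aᵢ zᵢ^{aᵢ−1}` for all `i` (the differentials of `P = Σ zᵢ^{aᵢ}`
  and of `Σ|zᵢ|²` are `ℂ`-dependent at `z`), then `|P(z)| = Σ|zᵢ|²`, or `|P(z)|² = (Σ|zᵢ|²)^p`, or `|z_last|^{p−2} = 2/p`;
* `hasFDerivAt_levelRadius` — the real derivative of `G = (P, Σ|zᵢ|²) : ℂ^{m+2} → ℂ × ℝ` (any exponents);
* **`surjective_fderiv_suspendedNodeLevelRadius`** and **`…_of_shell`** — `dG_z` is onto off the tangency set; in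
  particular on the shell `r₀² ≤ Σ|zᵢ|² ≤ r₂²` with `r₂ < min(1, (2/p)^{1/(p−2)})` for all fibre values `|P(z)| < r₀^p`
  (`p ≥ 3`) — including the singular fibre.

The linear algebra (`exists_sum_mul_eq_and_re_sum_mul_eq`, Milnor's Lemma 4.6 Case 1) is reused from the cyclic file.

## References

* [Milnor1968] J. Milnor, Singular Points of Complex Hypersurfaces, Ann. of Math. Studies 61 (1968), Cor. 2.9, Lemma 4.3,
  Lemma 4.6 (proof, Case 1; held text p0024), Thm. 4.8, §9 Lemma 9.4.
* [ArnoldGuseinzadeVarchenko2012] V. I. Arnold, S. M. Gusein-Zade, A. N. Varchenko, Singularities of Differentiable Maps,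
  Vol. 2, Part I §2.1 (the Milnor fibration; nonsingular fibres transverse to the sphere) and §2.3.
-/

noncomputable section

open Complex ContinuousMap Set Filter
open scoped ComplexConjugate BigOperators

namespace Literature.Geometry.ComplexAnalytic

namespace PhamBrieskorn

/-! ### The tangency trichotomy for `z₀² + ⋯ + zₘ² + z_{m+1}^p` -/

section Trichotomy

variable {m : ℕ} {a : Fin (m + 2) → ℕ} {p : ℕ} (h2 : ∀ i : Fin (m + 1), a i.castSucc = 2) (hp : a (Fin.last (m + 1)) = p)
include h2 hp

/-- `P(z) = Σ_{i ≤ m} zᵢ² + z_{m+1}^p` for the suspended-node exponents. [cite: Milnor1968, §9 p. 76] -/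
theorem sum_pow_suspendedNode (z : Fin (m + 2) → ℂ) :
    ∑ i, z i ^ a i = (∑ i : Fin (m + 1), z i.castSucc ^ 2) + z (Fin.last (m + 1)) ^ p := by
  rw [Fin.sum_univ_castSucc, hp]
  exact congrArg (· + _) (Finset.sum_congr rfl fun i _ => by rw [h2 i])

omit h2 hp in
/-- `Σ |zᵢ|² = Σ_{i ≤ m} |zᵢ|² + |z_{m+1}|²` on `ℂ^{m+2}`. [folklore] -/
private theorem sum_norm_sq_castSucc (z : Fin (m + 2) → ℂ) :
    ∑ i, ‖z i‖ ^ 2 = (∑ i : Fin (m + 1), ‖z i.castSucc‖ ^ 2) + ‖z (Fin.last (m + 1))‖ ^ 2 :=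
  Fin.sum_univ_castSucc _

omit h2 hp in
/-- From `conj w = c · w` with `w ≠ 0`: `|c| = 1`. [folklore] -/
private theorem norm_eq_one_of_conj_eq_mul_suspended {w c : ℂ} (hw : w ≠ 0) (h : conj w = c * w) : ‖c‖ = 1 := by
  have hn : ‖w‖ = ‖c‖ * ‖w‖ := by
    conv_lhs => rw [← Complex.norm_conj, h, norm_mul]
  have hw' : ‖w‖ ≠ 0 := norm_ne_zero_iff.2 hw
  field_simp at hn
  linarith [hn]

omit h2 hp in
/-- From `conj w = c · w`: `w² · c = |w|²` (also when `w = 0`). [folklore] -/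
private theorem sq_mul_eq_norm_sq_of_conj_eq_mul_suspended {w c : ℂ} (h : conj w = c * w) :
    w ^ 2 * c = ((‖w‖ ^ 2 : ℝ) : ℂ) := by
  calc w ^ 2 * c = w * (c * w) := by ring
    _ = w * conj w := by rw [h]
    _ = ((‖w‖ ^ 2 : ℝ) : ℂ) := by rw [Complex.mul_conj, Complex.normSq_eq_norm_sq, Complex.ofReal_pow]

/-- **The tangency trichotomy for the suspended `A_{p−1}` point.** If the differential of `Σ|zᵢ|²` is a complex multiple
of that of `P = Σ_{i≤m} zᵢ² + z_{m+1}^p` at `z` — `conj zᵢ = κ · aᵢ zᵢ^{aᵢ−1}` for all `i` — then either `|P(z)| = Σ|zᵢ|²`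
(the touching points with `z_{m+1} = 0`), or `|P(z)|² = (Σ|zᵢ|²)^p` (those with all quadratic coordinates zero), or
`|z_{m+1}|^{p−2} = 2/p`. [cite: Milnor1968, §9 Lemma 9.4, Cor. 2.9] [cite: ArnoldGuseinzadeVarchenko2012, Part I §2.1] -/
theorem suspendedNode_tangency_trichotomy (hp2 : 2 ≤ p) {z : Fin (m + 2) → ℂ} {κ : ℂ}
    (hκ : ∀ i : Fin (m + 2), conj (z i) = κ * ((a i : ℂ) * z i ^ (a i - 1))) :
    ‖∑ i, z i ^ a i‖ = ∑ i, ‖z i‖ ^ 2 ∨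
      ‖∑ i, z i ^ a i‖ ^ 2 = (∑ i, ‖z i‖ ^ 2) ^ p ∨
      ‖z (Fin.last (m + 1))‖ ^ (p - 2) = 2 / p := by
  rw [sum_pow_suspendedNode h2 hp, sum_norm_sq_castSucc]
  have hq : ∀ i : Fin (m + 1), conj (z i.castSucc) = (2 * κ) * z i.castSucc := fun i => by
    rw [hκ i.castSucc, h2 i]; push_cast; ring
  have hl : conj (z (Fin.last (m + 1))) = κ * ((p : ℂ) * z (Fin.last (m + 1)) ^ (p - 1)) := by
    rw [hκ (Fin.last (m + 1)), hp]
  by_cases h0 : ∀ i : Fin (m + 1), z i.castSucc = 0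
  · -- all quadratic coordinates vanish: `P = z_last^p`, `|P|² = |z_last|^{2p}`
    right; left
    simp only [h0, norm_zero, ne_eq, OfNat.ofNat_ne_zero, not_false_eq_true, zero_pow, Finset.sum_const_zero, zero_add,
      norm_pow]
    rw [← pow_mul, mul_comm, pow_mul]
  · -- some quadratic `z_j ≠ 0`: `|2κ| = 1`
    obtain ⟨j, hj⟩ := not_forall.1 h0
    have hk : ‖2 * κ‖ = 1 := norm_eq_one_of_conj_eq_mul_suspended hj (hq j)
    have hκ0 : κ ≠ 0 := by rintro rfl; simp at hk
    have hnκ : ‖κ‖ = 1 / 2 := by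
      rw [norm_mul, Complex.norm_two] at hk
      linarith
    by_cases hzl : z (Fin.last (m + 1)) = 0
    · -- `z_last = 0`: `P = Σ zᵢ² = (Σ|zᵢ|²)/(2κ)`
      left
      have hP : ((∑ i : Fin (m + 1), z i.castSucc ^ 2) + z (Fin.last (m + 1)) ^ p) * (2 * κ) =
          ((∑ i : Fin (m + 1), ‖z i.castSucc‖ ^ 2 : ℝ) : ℂ) := by
        rw [hzl, zero_pow (by omega), add_zero, Finset.sum_mul, Complex.ofReal_sum]
        exact Finset.sum_congr rfl fun i _ => sq_mul_eq_norm_sq_of_conj_eq_mul_suspended (hq i)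
      have hn := congrArg (fun w : ℂ => ‖w‖) hP
      simp only [norm_mul, hk, mul_one] at hn
      rw [hn, hzl, norm_zero, Complex.norm_real, Real.norm_eq_abs, abs_of_nonneg (by positivity)]
      ring
    · -- `z_last ≠ 0`: `|z_last| = p|κ||z_last|^{p-1}`, so `|z_last|^{p-2} = 2/p`
      right; right
      have hn := congrArg (fun w : ℂ => ‖w‖) hl
      simp only [Complex.norm_conj, norm_mul, norm_pow, Complex.norm_natCast, hnκ] at hn
      have hz' : 0 < ‖z (Fin.last (m + 1))‖ := norm_pos_iff.2 hzl
      have hp0 : (0 : ℝ) < p := by exact_mod_cast (show 0 < p by omega)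
      have hpow : ‖z (Fin.last (m + 1))‖ ^ (p - 1) = ‖z (Fin.last (m + 1))‖ ^ (p - 2) * ‖z (Fin.last (m + 1))‖ := by
        rw [← pow_succ, show p - 2 + 1 = p - 1 by omega]
      rw [hpow] at hn
      field_simp at hn
      have : ‖z (Fin.last (m + 1))‖ ^ (p - 2) * (p : ℝ) = 2 := by nlinarith [hn, hz']
      field_simp
      linarith

end Trichotomy

/-! ### The differential of `(P, Σ|zᵢ|²)` and its surjectivity off the tangency set -/

section Differential

variable {m : ℕ} (a : Fin (m + 2) → ℕ)

/-- **The real derivative of `G(z) = (Σ zᵢ^{aᵢ}, Σ |zᵢ|²) : ℂ^{m+2} → ℂ × ℝ`** at `z` is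
`v ↦ (Σ aᵢ zᵢ^{aᵢ−1} vᵢ, 2 Re Σ conj zᵢ · vᵢ)` (any exponents). [cite: Milnor1968, §4 Lemma 4.3] -/
theorem hasFDerivAt_levelRadius (z : Fin (m + 2) → ℂ) :
    ∃ L : (Fin (m + 2) → ℂ) →L[ℝ] ℂ × ℝ,
      HasFDerivAt (fun z : Fin (m + 2) → ℂ => ((∑ i, z i ^ a i : ℂ), (∑ i, ‖z i‖ ^ 2 : ℝ))) L z ∧
      ∀ v, L v = (∑ i, ((a i : ℂ) * z i ^ (a i - 1)) * v i, 2 * (∑ i, conj (z i) * v i).re) := by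
  have hP : HasFDerivAt (fun z : Fin (m + 2) → ℂ => ∑ i, z i ^ a i)
      (∑ i : Fin (m + 2), (a i • z i ^ (a i - 1)) •
        ContinuousLinearMap.proj (R := ℂ) (φ := fun _ : Fin (m + 2) => ℂ) i) z :=
    HasFDerivAt.fun_sum fun i _ => (hasFDerivAt_apply (𝕜 := ℂ) i z).pow (a i)
  have hR : HasFDerivAt (fun z : Fin (m + 2) → ℂ => ∑ i, ‖z i‖ ^ 2)
      (∑ i : Fin (m + 2), (2 : ℕ) • (innerSL ℝ (z i)).comp
        (ContinuousLinearMap.proj (R := ℝ) (φ := fun _ : Fin (m + 2) => ℂ) i)) z :=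
    HasFDerivAt.fun_sum fun i _ => (hasFDerivAt_apply (𝕜 := ℝ) i z).norm_sq
  refine ⟨_, (hP.restrictScalars ℝ).prodMk hR, fun v => ?_⟩
  rw [ContinuousLinearMap.prod_apply, Prod.mk.injEq]
  constructor
  · rw [ContinuousLinearMap.coe_restrictScalars', sum_apply]
    refine Finset.sum_congr rfl fun i _ => ?_
    rw [smul_apply, ContinuousLinearMap.proj_apply, smul_eq_mul, nsmul_eq_mul]
  · rw [sum_apply, Complex.re_sum, Finset.mul_sum]
    refine Finset.sum_congr rfl fun i _ => ?_
    rw [smul_apply, ContinuousLinearMap.comp_apply, ContinuousLinearMap.proj_apply,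
      innerSL_apply_apply, Complex.inner, nsmul_eq_mul, Nat.cast_ofNat, Complex.mul_re, Complex.mul_re,
      Complex.conj_re, Complex.conj_im]
    ring

variable {a} {p : ℕ} (h2 : ∀ i : Fin (m + 1), a i.castSucc = 2) (hp : a (Fin.last (m + 1)) = p)
include h2 hp

/-- All suspended-node exponents are `≥ 2` (`p ≥ 2`). [cite: Milnor1968, §9 p. 76] -/
theorem two_le_suspendedNode (hp2 : 2 ≤ p) (i : Fin (m + 2)) : 2 ≤ a i := by
  refine Fin.lastCases ?_ (fun j => ?_) i
  · rw [hp]; exact hp2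
  · rw [h2 j]

/-- **The fibres of the suspended node are transverse to the spheres away from the tangency set**: if `z ≠ 0`,
`|z_{m+1}|^{p−2} < 2/p`, `|P(z)| < Σ|zᵢ|²` and `|P(z)|² < (Σ|zᵢ|²)^p`, then the real differential of
`G = (P, Σ|zᵢ|²) : ℂ^{m+2} → ℂ × ℝ` at `z` is ONTO. [cite: Milnor1968, Cor. 2.9, §9 Lemma 9.4]
[cite: ArnoldGuseinzadeVarchenko2012, Part I §2.1] -/
theorem surjective_fderiv_suspendedNodeLevelRadius (hp2 : 2 ≤ p) {z : Fin (m + 2) → ℂ} (hz : z ≠ 0)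
    (hl : ‖z (Fin.last (m + 1))‖ ^ (p - 2) < 2 / p) (hP₁ : ‖∑ i, z i ^ a i‖ < ∑ i, ‖z i‖ ^ 2)
    (hP₂ : ‖∑ i, z i ^ a i‖ ^ 2 < (∑ i, ‖z i‖ ^ 2) ^ p) :
    Function.Surjective (fderiv ℝ
      (fun z : Fin (m + 2) → ℂ => ((∑ i, z i ^ a i : ℂ), (∑ i, ‖z i‖ ^ 2 : ℝ))) z) := by
  obtain ⟨L, hL, hLv⟩ := hasFDerivAt_levelRadius a z
  rw [hL.fderiv]
  -- the gradient vector `b₁` and the radius covector `conj z`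
  set b₁ : Fin (m + 2) → ℂ := fun i => (a i : ℂ) * z i ^ (a i - 1) with hb₁_def
  have hb₁ : b₁ ≠ 0 := by
    intro hb0
    apply hz
    funext i
    have hi : (a i : ℂ) * z i ^ (a i - 1) = 0 := congrFun hb0 i
    have hne : (a i : ℂ) ≠ 0 := by
      have := two_le_suspendedNode h2 hp hp2 i
      exact_mod_cast (show a i ≠ 0 by omega)
    have hexp : a i - 1 ≠ 0 := by
      have := two_le_suspendedNode h2 hp hp2 i
      omega
    rcases mul_eq_zero.1 hi with h | h
    · exact absurd h hne
    · exact (pow_eq_zero_iff hexp).1 h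
  have hb : ∀ κ : ℂ, (fun i => conj (z i)) ≠ κ • b₁ := by
    intro κ hκ
    have hκ' : ∀ i : Fin (m + 2), conj (z i) = κ * ((a i : ℂ) * z i ^ (a i - 1)) := fun i => congrFun hκ i
    rcases suspendedNode_tangency_trichotomy h2 hp hp2 hκ' with h | h | h
    · exact absurd h hP₁.ne
    · exact absurd h hP₂.ne
    · exact absurd h hl.ne
  rintro ⟨x, t⟩
  obtain ⟨v, hv₁, hv₂⟩ := exists_sum_mul_eq_and_re_sum_mul_eq hb₁ hb x (t / 2)
  refine ⟨v, ?_⟩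
  rw [hLv, Prod.mk.injEq]
  exact ⟨hv₁, by rw [hv₂]; ring⟩

/-- **Shell form.** For radii `0 < r₀ ≤ r₂` with `r₂ < 1` and `r₂^{p−2} < 2/p` (`p ≥ 3`), at every point of the closed
shell `r₀² ≤ Σ|zᵢ|² ≤ r₂²` lying on a fibre `|P(z)| < r₀^p` — in particular on the singular fibre `P = 0` — the differential
of `(P, Σ|zᵢ|²)` is onto: ALL these fibres cross the shell transversally to the spheres.
[cite: Milnor1968, Cor. 2.9, Thm. 4.8, §9 Lemma 9.4] [cite: ArnoldGuseinzadeVarchenko2012, Part I §2.1] -/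
theorem surjective_fderiv_suspendedNodeLevelRadius_of_shell (hp3 : 3 ≤ p) {r₀ r₂ : ℝ} (hr₀ : 0 < r₀) (hr₀₂ : r₀ ≤ r₂)
    (hr₂ : r₂ < 1) (hr₂' : r₂ ^ (p - 2) < 2 / p) {z : Fin (m + 2) → ℂ} (hlow : r₀ ^ 2 ≤ ∑ i, ‖z i‖ ^ 2)
    (hup : ∑ i, ‖z i‖ ^ 2 ≤ r₂ ^ 2) (hP : ‖∑ i, z i ^ a i‖ < r₀ ^ p) :
    Function.Surjective (fderiv ℝ
      (fun z : Fin (m + 2) → ℂ => ((∑ i, z i ^ a i : ℂ), (∑ i, ‖z i‖ ^ 2 : ℝ))) z) := by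
  have hρpos : 0 < ∑ i, ‖z i‖ ^ 2 := lt_of_lt_of_le (by positivity) hlow
  have hz : z ≠ 0 := by
    rintro rfl
    simp at hρpos
  have hr₂pos : 0 < r₂ := hr₀.trans_le hr₀₂
  -- `‖z_last‖ ≤ r₂`, so `‖z_last‖^(p-2) < 2/p`
  have hzl : ‖z (Fin.last (m + 1))‖ ≤ r₂ := by
    have h1 : ‖z (Fin.last (m + 1))‖ ^ 2 ≤ ∑ i, ‖z i‖ ^ 2 :=
      Finset.single_le_sum (fun j _ => sq_nonneg ‖z j‖) (Finset.mem_univ (Fin.last (m + 1)))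
    exact (pow_le_pow_iff_left₀ (norm_nonneg _) hr₂pos.le two_ne_zero).1 (h1.trans hup)
  have hl : ‖z (Fin.last (m + 1))‖ ^ (p - 2) < 2 / p :=
    lt_of_le_of_lt (pow_le_pow_left₀ (norm_nonneg _) hzl _) hr₂'
  -- `‖P‖ < r₀^p ≤ r₀² ≤ Σ|zᵢ|²`
  have hr₀1 : r₀ ≤ 1 := hr₀₂.trans hr₂.le
  have hP₁ : ‖∑ i, z i ^ a i‖ < ∑ i, ‖z i‖ ^ 2 :=
    lt_of_lt_of_le hP ((pow_le_pow_of_le_one hr₀.le hr₀1 (by omega : 2 ≤ p)).trans hlow)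
  -- `‖P‖² < r₀^{2p} = (r₀²)^p ≤ (Σ|zᵢ|²)^p`
  have hP₂ : ‖∑ i, z i ^ a i‖ ^ 2 < (∑ i, ‖z i‖ ^ 2) ^ p := by
    have h1 : ‖∑ i, z i ^ a i‖ ^ 2 < (r₀ ^ p) ^ 2 := pow_lt_pow_left₀ hP (norm_nonneg _) two_ne_zero
    rw [← pow_mul, mul_comm, pow_mul] at h1
    exact lt_of_lt_of_le h1 (pow_le_pow_left₀ (by positivity) hlow p)
  exact surjective_fderiv_suspendedNodeLevelRadius h2 hp (by omega) hz hl hP₁ hP₂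

end Differential

end PhamBrieskorn

end Literature.Geometry.ComplexAnalytic

end
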